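import Summits.NavierStokesRegularity.NavierStokesRegularity.Theorems.FilamentSkeletonRssKelvinGateRotationKernel
import Summits.NavierStokesRegularity.NavierStokesRegularity.Theorems.FilamentSkeletonRssKelvinGateTools
import Literature.Analysis.FluidPDE.DistributionalPressurePoisson

/-!
# Route `FilamentSkeletonRss` · crux `TransverseReductionRJ` (stmt-NavierStokesRegularity-21221) — line `kelvin_gate`,
# stub S2′ `EventualKelvinGate`: the free linearised operator maps GRADIENTS to GRADIENTS (the pressure bookkeeping)

Helper file (theorems only, `--supports stmt-NavierStokesRegularity-21221 --as helper`).  HONEST FRAMING: analysis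
bookkeeping for a HYPOTHETICAL filament-type rotating-self-similar blow-up route; nothing here bears on Navier–Stokes
regularity; no stub is proved here.

For the free linearised profile operator `𝓛_(α,0) W = α (e₃ × W − DW[e₃ × y]) + ½ W + ½ DW[y] − ΔW`
(`Theorems.KelvinGate.lerayLin α 0`) and a `C³` scalar `φ`:

* `lerayLin_zero_gradient` — **`𝓛_(α,0)(∇φ) = ∇(α 𝓡ₛφ + ½ Dφ[y] − Δφ)`**, `𝓡ₛφ(y) = −Dφ(y)[e₃ × y]`
  (`gradient_rotScalar_eq` of `…RotationKernel` for the rotation term, `Δ∇ = ∇Δ`, and `∇(Dφ[y]) = D(∇φ)[y] + ∇φ`);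
* `lerayLin_sub_gradient_add_gradient` — hence the PRESSURE BOOKKEEPING of the free gate: if `𝓛_(α,0) W̃ = F` then
  `W := W̃ − ∇φ` solves `𝓛_(α,0) W + ∇q = F` with `q := α 𝓡ₛφ + ½ Dφ[y] − Δφ`; choosing `Δφ = div W̃` makes `W` solenoidal
  (Helmholtz correction of the velocity resolvent of `…KelvinGateFreeResolvent`; the analytic part — a weighted `C³` Newton
  potential of `div W̃` — is not in this file).
-/

set_option linter.dupNamespace false

noncomputable section

namespace Summit.NavierStokesRegularity.NavierStokesRegularity.Theorems.KelvinGate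

open Set Function Filter
open Literature.Analysis.FluidPDE
open scoped InnerProductSpace Laplacian ContDiff Topology

/-! ## `∇(Dφ[y]) = D(∇φ)(y)[y] + ∇φ(y)` -/

/-- The gradient of the transport scalar `y ↦ Dφ(y)[y]` of a `C²` function: `∇(Dφ[y])(y) = D(∇φ)(y)[y] + ∇φ(y)`. -/
theorem gradient_fderiv_apply_self {φ : EuclideanSpace ℝ (Fin 3) → ℝ} (hφ : ContDiff ℝ 2 φ) (y : EuclideanSpace ℝ (Fin 3)) :
    gradient (fun z => fderiv ℝ φ z z) y = fderiv ℝ (gradient φ) y y + gradient φ y := by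
  have hd : DifferentiableAt ℝ (fderiv ℝ φ) y := ((hφ.fderiv_right (m := 1) le_rfl).differentiable one_ne_zero) y
  have hD : HasFDerivAt (fun z => fderiv ℝ φ z z)
      ((fderiv ℝ φ y).comp (ContinuousLinearMap.id ℝ _) + (fderiv ℝ (fderiv ℝ φ) y).flip y) y := by
    simpa using hd.hasFDerivAt.clm_apply (hasFDerivAt_id y)
  apply ext_inner_right ℝ
  intro v
  rw [← fderiv_apply_eq_inner_gradient, hD.fderiv, inner_add_left, ← fderiv_apply_eq_inner_gradient]
  simp only [add_apply, ContinuousLinearMap.coe_comp, comp_apply, ContinuousLinearMap.coe_id',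
    id_eq, ContinuousLinearMap.flip_apply]
  -- `D²φ(y)[v][y] = ⟪D(∇φ)(y) y, v⟫`
  have hgrad : gradient φ = (InnerProductSpace.toDual ℝ (EuclideanSpace ℝ (Fin 3))).symm ∘ fderiv ℝ φ := rfl
  have h2 : fderiv ℝ (fderiv ℝ φ) y v y = ⟪fderiv ℝ (gradient φ) y v, y⟫_ℝ := by
    rw [hgrad, LinearIsometryEquiv.comp_fderiv]
    change _ = ⟪(InnerProductSpace.toDual ℝ (EuclideanSpace ℝ (Fin 3))).symm (fderiv ℝ (fderiv ℝ φ) y v), y⟫_ℝ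
    rw [InnerProductSpace.toDual_symm_apply]
  rw [h2, inner_fderiv_gradient_comm hφ y v y, add_comm]

/-! ## `𝓛_(α,0)` on gradients -/

/-- **The free linearised operator maps gradients to gradients**: for `φ ∈ C³` and every rate `α`,
`𝓛_(α,0)(∇φ)(y) = ∇(z ↦ α · (−Dφ(z)[e₃ × z]) + ½ · Dφ(z)[z] − Δφ(z))(y)`. -/
theorem lerayLin_zero_gradient (α : ℝ) {φ : EuclideanSpace ℝ (Fin 3) → ℝ} (hφ : ContDiff ℝ 3 φ) (y : EuclideanSpace ℝ (Fin 3)) :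
    lerayLin α (fun _ => 0) (gradient φ) y =
      gradient (fun z => α * (-(fderiv ℝ φ z) (cross (EuclideanSpace.single 2 1) z)) +
        (1/2:ℝ) * fderiv ℝ φ z z - (Δ φ) z) y := by
  have hφ2 : ContDiff ℝ 2 φ := hφ.of_le (by norm_num)
  -- differentiability of the three scalars
  have hgc : ContDiff ℝ 2 (gradient φ) :=
    (InnerProductSpace.toDual ℝ (EuclideanSpace ℝ (Fin 3))).symm.contDiff.comp (hφ.fderiv_right (m := 2) le_rfl)
  have hrot : DifferentiableAt ℝ (fun z => -(fderiv ℝ φ z) (cross (EuclideanSpace.single 2 1) z)) y := by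
    have h1 : ContDiff ℝ 1 (fderiv ℝ φ) := hφ.fderiv_right (m := 1) (by norm_num)
    have h2 : ContDiff ℝ 1 (fun z : EuclideanSpace ℝ (Fin 3) => cross (EuclideanSpace.single 2 1) z) := by
      simp only [cross_single_two_eq_rotGenL]; exact rotGenL.contDiff
    exact ((h1.clm_apply h2).neg.differentiable one_ne_zero) y
  have htr : DifferentiableAt ℝ (fun z => fderiv ℝ φ z z) y :=
    (((hφ.fderiv_right (m := 1) (by norm_num)).clm_apply contDiff_id).differentiable one_ne_zero) y
  have hΔ : DifferentiableAt ℝ (Δ φ) y := ((contDiff_one_laplacian hφ).differentiable one_ne_zero) y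
  -- split the gradient of the sum
  have hsplit : gradient (fun z => α * (-(fderiv ℝ φ z) (cross (EuclideanSpace.single 2 1) z)) +
        (1/2:ℝ) * fderiv ℝ φ z z - (Δ φ) z) y =
      α • gradient (fun z => -(fderiv ℝ φ z) (cross (EuclideanSpace.single 2 1) z)) y +
        (1/2:ℝ) • gradient (fun z => fderiv ℝ φ z z) y - gradient (Δ φ) y := by
    have hA : DifferentiableAt ℝ (fun z => α * (-(fderiv ℝ φ z) (cross (EuclideanSpace.single 2 1) z)) +
        (1/2:ℝ) * fderiv ℝ φ z z) y := (hrot.const_mul α).add (htr.const_mul _)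
    simp only [gradient]
    rw [fderiv_fun_sub hA hΔ, fderiv_fun_add (hrot.const_mul α) (htr.const_mul _),
      fderiv_const_mul hrot, fderiv_const_mul htr]
    simp only [map_sub, map_add, map_smul]
  rw [hsplit, gradient_rotScalar_eq φ hφ2 y, gradient_fderiv_apply_self hφ2 y, ← laplacian_gradient hφ y]
  unfold lerayLin
  simp only [fderiv_fun_const, Pi.zero_apply, zero_apply, map_zero, add_zero, smul_add, smul_sub]
  abel

/-- **Pressure bookkeeping of the free gate.**  If `W̃ ∈ C²` solves `𝓛_(α,0) W̃ = F` at `y` and `φ ∈ C³`, then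
`W := W̃ − ∇φ` solves `𝓛_(α,0) W (y) + ∇q(y) = F(y)` with `q := α · (−Dφ[e₃ × ·]) + ½ · Dφ[·] − Δφ`. -/
theorem lerayLin_sub_gradient_add_gradient (α : ℝ) {W F : EuclideanSpace ℝ (Fin 3) → EuclideanSpace ℝ (Fin 3)}
    {φ : EuclideanSpace ℝ (Fin 3) → ℝ} (hW : ContDiff ℝ 2 W) (hφ : ContDiff ℝ 3 φ) (y : EuclideanSpace ℝ (Fin 3))
    (hF : lerayLin α (fun _ => 0) W y = F y) :
    lerayLin α (fun _ => 0) (fun z => W z - gradient φ z) y +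
      gradient (fun z => α * (-(fderiv ℝ φ z) (cross (EuclideanSpace.single 2 1) z)) + (1/2:ℝ) * fderiv ℝ φ z z - (Δ φ) z) y =
      F y := by
  have hgc : ContDiff ℝ 2 (gradient φ) :=
    (InnerProductSpace.toDual ℝ (EuclideanSpace ℝ (Fin 3))).symm.contDiff.comp (hφ.fderiv_right (m := 2) le_rfl)
  have hfun : (fun z => W z - gradient φ z) = fun z => W z + (-1:ℝ) • gradient φ z := by
    funext z; simp [sub_eq_add_neg]
  rw [hfun, lerayLin_add_smul α (-1) (fun _ => 0) W (gradient φ) y hW.contDiffAt hgc.contDiffAt,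
    lerayLin_zero_gradient α hφ y, hF]
  simp

end Summit.NavierStokesRegularity.NavierStokesRegularity.Theorems.KelvinGate

end
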